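import Summits.BirchSwinnertonDyer.BirchSwinnertonDyer.Theorems.GenusKolyvaginAtTwoVisiblePairAtTwoInputReductionsHeegner
import Summits.BirchSwinnertonDyer.BirchSwinnertonDyer.Theorems.GenusKolyvaginAtTwoVisiblePairAtTwoInstanceDefs
import Summits.BirchSwinnertonDyer.BirchSwinnertonDyer.Theorems.GenusKolyvaginAtTwoEquivariantKolyvaginExactAtTwoEigenClassesFinite
import Summits.BirchSwinnertonDyer.BirchSwinnertonDyer.Theorems.GenusKolyvaginAtTwoEquivariantKolyvaginExactAtTwoArchimedeanSelmerLevel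
import HarnessLib

/-!
# Route `GenusKolyvaginAtTwo`, LINE 6, KEY crux Q3 / U-half `ShaCardDvdPowAtTwoR` (stmt-BirchSwinnertonDyer-28029):
# the habitat condition (H2) `Input.sel_visible` is INCONSISTENT with `x_ord` on the DEF-free Heegner habitat —
# the ℚ-pair instance record `VisiblePairAtTwo.Input` is UNINHABITED there (the "bottom bit of `1 + ετ`" at `p = 2`)

NEGATIVE structural helper (seat `bsd-line-gk2-p3` g13; `--supports`, closes nothing; not a refutation of any route decl).

(H2), as typed in `VisiblePairAtTwo.Input.sel_visible` (p638903), asks that `Sel^{(2^M)}(E/ℚ) ⊕ Sel^{(2^M)}(E^{(d_K)}/ℚ)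
→ H = Fun(Γ_{K(E_K[2^M])}, E[2^M])`, `(s₁, s₂) ↦ rK₁ s₁ + rK₂ s₂`, be jointly injective. At an ODD prime this is the
`±`-decomposition of `Sel(E/K)` (McCallum 1991 p. 299; Gross 1991 (5.1)). AT `p = 2` the `+` and `−` parts meet in the
`2`-torsion: for every `s₁ ∈ Sel^{(2^M)}(E/ℚ)` with `2 s₁ = 0`, `y := res s₁` satisfies `τy = y = −y`, so `y = hPsiKT (res s₂)`
for a unique `s₂ ∈ H¹(ℚ, E^{(d_K)}[2^M])` (`EigenClassesFinite`, `E(K)[2] = 0`), and `s₂` IS SELMER over `ℚ` on the DEF-free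
Heegner habitat — this is exactly this lineage's place-by-place `K → ℚ` transfer for the twin
(`mem_selmerLocalKer_twin_of_K_of_heegner`, p651084; `∞` free on `Δ < 0`). Then `rK₁ s₁ + rK₂ s₂ = rK₁ (2 s₁) = 0` with
`s₁ ≠ 0`:

* `exists_selmer_twin_rK₁_add_rK₂_eq_zero` — **for every `2`-torsion Selmer class `s₁` of `E` there is a Selmer class `s₂`
  of `E^{(d_K)}` with `rK₁ s₁ + rK₂ s₂ = 0`** (habitat: `ρ̄_{E,2}` onto, `K = ℚ(θ)`, `θ² = d_K` odd, Heegner hypothesis,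
  `Δ(E) < 0`, DEF-free `∀ v ∣ d_K, #E(ℚ_v)[2] = 1`);
* `not_sel_visible_of_exists_two_torsion` — hence **(H2) fails as soon as `Sel^{(2^M)}(E/ℚ)[2] ≠ 0`**;
* `input_isEmpty_of_DEF_free` — **`VisiblePairAtTwo.Input W K M hθ hθsq` is uninhabited** on that habitat (`M ≥ 1`): its own
  fields `x_mem`, `x_ord` produce the `2`-torsion Selmer class `2^{M−1} x ≠ 0`, contradicting `sel_visible`. Consequently every
  theorem of the LINE-6 ℚ-pair chain taking `I : Input …` or `sel_visible` together with `x_ord` + DEF-freeness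
  (`…ClaimsOfK`, `…ClaimsOfHeegner`, `…ShallowExactness*`, `visiblePair I`) is VACUOUSLY true on the DEF-free habitat.

Repair for the planners (not typed here): replace (H2) by its `2`-torsion-tolerant form `rK₁ s₁ + rK₂ s₂ = 0 → 2 s₁ = 0 ∧ 2 s₂ = 0`
(true: apply `τ`), and carry Kolyvagin's index-`2` allowance per descent step into the conclusion (`#Ш ∣ 2^{2M₀ + c}`), cf. the
`why_might_fail` of 27720/28029. THEOREMS ONLY (no definition, no named fact, no `sorry`, standard axioms). BSD is not proved by
any of this.

References: [McCallumLMS1991] p. 299 and §5; [GrossLMS1991] §5 (5.1); [Kolyvagin1989Izv] §3; [KolyvaginEulerSystems1990] Thm. A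
(the error term at `p = 2`).
-/

set_option autoImplicit false
set_option linter.dupNamespace false -- tree convention: `Summit.BirchSwinnertonDyer.BirchSwinnertonDyer.Theorems` (summit = sub-problem)

noncomputable section

open scoped Classical

namespace Summit.BirchSwinnertonDyer.BirchSwinnertonDyer.Theorems.GenusExact.VisiblePairAtTwo

open WeierstrassCurve NumberField IsDedekindDomain Field
open Literature.NumberTheory.EllipticCurves Literature.NumberTheory.GaloisRepresentations
open Literature.NumberTheory.EllipticCurves.KolyvaginDescent
open Summit.BirchSwinnertonDyer.BirchSwinnertonDyer.Theorems.GenusExact.EigenClassesFinite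
open Summit.BirchSwinnertonDyer.BirchSwinnertonDyer.Theorems.GenusExact.ArchVanishing

variable (W : WeierstrassCurve ℚ) [W.IsElliptic] [W.IsGloballyMinimal] [NeZero (W.conductorNorm ℤ)]
  (K : Type) [Field K] [NumberField K] (M : ℕ) {θ : K} (hθ : θ ∉ Set.range (algebraMap ℚ K))
  (hθsq : θ ^ 2 = algebraMap ℚ K ((NumberField.discr K : ℤ) : ℚ))

omit [W.IsGloballyMinimal] [NeZero (W.conductorNorm ℤ)] in
/-- **Every `2`-torsion Selmer class of `E` pairs off with a Selmer class of the twin in `H`.** On the habitat (`ρ̄_{E,2}` onto,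
`K = ℚ(θ)` quadratic with `θ² = d_K` odd, Heegner hypothesis for `N_E`, `Δ(E) < 0`, `∀ v ∣ d_K, #E(ℚ_v)[2] = 1`): for
`s₁ ∈ Sel^{(2^M)}(E/ℚ)` with `2 s₁ = 0` there is `s₂ ∈ Sel^{(2^M)}(E^{(d_K)}/ℚ)` with `hPsiKT (res s₂) = res s₁` and
`rK₁ s₁ + rK₂ s₂ = 0`. [cite: GrossLMS1991, §5 (5.1)] [cite: McCallumLMS1991, p. 299] -/
theorem exists_selmer_twin_rK₁_add_rK₂_eq_zero [(twin W K).IsElliptic] (h2 : Module.finrank ℚ K = 2)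
    (hodd : Odd (NumberField.discr K)) (hH : SatisfiesHeegnerHypothesis (W.conductorNorm ℤ) K)
    (hs : W.HasSurjectiveModNGaloisRep 2) (hΔ : W.Δ < 0)
    (htors : ∀ v : HeightOneSpectrum (𝓞 ℚ), ((NumberField.discr K : ℤ) : 𝓞 ℚ) ∈ v.asIdeal →
      Nat.card (nsmulAddMonoidHom 2 : (W.baseChange (v.adicCompletion ℚ)).toAffine.Point →+ _).ker = 1)
    {s₁ : galH1Torsion W (lvl M)} (hs₁ : s₁ ∈ selmerGroup W (lvl M)) (h2s₁ : (2 : ℤ) • s₁ = 0) :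
    ∃ s₂ ∈ selmerGroup (twin W K) (lvl M),
      hPsiKT W K hθ hθsq (lvl M) (resTorsion (twin W K) K (lvl M) s₂) = resTorsion W K (lvl M) s₁ ∧
      rK₁ W K M s₁ + rK₂ W M hθ hθsq s₂ = 0 := by
  haveI : IsGalois ℚ K := isGalois_of_finrank_eq_two K h2
  have hL := forall_zsmul_two_pow_baseChange_eq_zero_of_hasSurjectiveModNGaloisRep_two W K h2 hs M
  set y := resTorsion W K (lvl M) s₁ with hy
  -- `y` is `τ`-fixed (a restricted class) and `2 y = 0`, so `τ y = -y`
  have h2y : (2 : ℤ) • y = 0 := by rw [hy, ← map_zsmul, h2s₁, map_zero]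
  have hyneg : y = -y := by
    rw [eq_neg_iff_add_eq_zero, ← two_zsmul]
    exact h2y
  have hτy : conjAct W (sigmaQ K h2 hθ hθsq) (lvl M) y = -y := by
    rw [hy, conjAct_resTorsion K W (lvl M) (sigmaQ K h2 hθ hθsq) h2 (sigmaQ_ne_one K h2 hθ hθsq) s₁, ← hy]
    exact hyneg
  obtain ⟨s₂, hs₂, -⟩ := existsUnique_hPsiKT_resTorsion_eq_of_conjAct_eq_neg W K h2 hθ hθsq (lvl M) hL hτy
  -- `y` is Selmer over `K`
  have hyK := resTorsion_mem_selmerGroup W K (lvl M) hs₁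
  rw [mem_selmerGroup_iff] at hyK
  refine ⟨s₂, ?_, hs₂, ?_⟩
  · -- `s₂` is Selmer over `ℚ`: finite places by the twin transfer, `∞` free
    rw [mem_selmerGroup_iff]
    refine ⟨fun v ↦ mem_selmerLocalKer_twin_of_K_of_heegner W h2 hθ hθsq hodd hH (lvl M) hs₂ v
      (fun hv ↦ by rw [natCard_ker_two_twin_adicCompletion_eq]; exact htors v hv) (fun w _ ↦ hyK.1 w), fun w ↦ ?_⟩
    have hd : ((NumberField.discr K : ℤ) : ℚ) ≠ 0 := by exact_mod_cast NumberField.discr_ne_zero K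
    exact mem_selmerLocalKer_infinitePlace_quadraticTwist_of_Δ_neg W w hΔ hd (lvl M) s₂
  · -- `rK₁ s₁ + rK₂ s₂ = rK₁ s₁ + rK₁ s₁ = rK₁ (2 s₁) = 0`
    have hrK : rK₂ W M hθ hθsq s₂ = rK₁ W K M s₁ := by
      funext ρ
      show h1EvalHom (W.baseChange K) (lvl M) ρ.2
          (hPsiKT W K hθ hθsq (lvl M) (resTorsion (twin W K) K (lvl M) s₂)) =
        h1EvalHom (W.baseChange K) (lvl M) ρ.2 (resTorsion W K (lvl M) s₁)
      rw [hs₂]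
    rw [hrK, ← two_zsmul, ← map_zsmul, h2s₁, map_zero]

omit [W.IsGloballyMinimal] [NeZero (W.conductorNorm ℤ)] in
/-- **(H2) fails whenever `Sel^{(2^M)}(E/ℚ)` has a non-zero `2`-torsion class** (same habitat). [cite: McCallumLMS1991, p. 299]
[cite: KolyvaginEulerSystems1990, Thm. A] -/
theorem not_sel_visible_of_exists_two_torsion [(twin W K).IsElliptic] (h2 : Module.finrank ℚ K = 2)
    (hodd : Odd (NumberField.discr K)) (hH : SatisfiesHeegnerHypothesis (W.conductorNorm ℤ) K)
    (hs : W.HasSurjectiveModNGaloisRep 2) (hΔ : W.Δ < 0)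
    (htors : ∀ v : HeightOneSpectrum (𝓞 ℚ), ((NumberField.discr K : ℤ) : 𝓞 ℚ) ∈ v.asIdeal →
      Nat.card (nsmulAddMonoidHom 2 : (W.baseChange (v.adicCompletion ℚ)).toAffine.Point →+ _).ker = 1)
    {s₁ : galH1Torsion W (lvl M)} (hs₁ : s₁ ∈ selmerGroup W (lvl M)) (h2s₁ : (2 : ℤ) • s₁ = 0) (hne : s₁ ≠ 0) :
    ¬ ∀ t₁ ∈ selmerGroup W (lvl M), ∀ t₂ ∈ selmerGroup (twin W K) (lvl M),
      rK₁ W K M t₁ + rK₂ W M hθ hθsq t₂ = 0 → t₁ = 0 ∧ t₂ = 0 := by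
  intro hvis
  obtain ⟨s₂, hs₂, -, hsum⟩ :=
    exists_selmer_twin_rK₁_add_rK₂_eq_zero W K M hθ hθsq h2 hodd hH hs hΔ htors hs₁ h2s₁
  exact hne (hvis s₁ hs₁ s₂ hs₂ hsum).1

omit [NeZero (W.conductorNorm ℤ)] in
/-- **The instance record `VisiblePairAtTwo.Input` is uninhabited on the DEF-free Heegner habitat** (`M ≥ 1`, `ρ̄_{E,2}` onto,
`θ² = d_K` odd, Heegner hypothesis, `Δ(E) < 0`, `∀ v ∣ d_K, #E(ℚ_v)[2] = 1`): `2^{M−1}·I.x` is a non-zero (`x_ord`) `2`-torsion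
Selmer (`x_mem`) class, against `I.sel_visible`. [cite: McCallumLMS1991, p. 299 and §5] [cite: KolyvaginEulerSystems1990, Thm. A] -/
theorem input_isEmpty_of_DEF_free [(twin W K).IsElliptic] (h2 : Module.finrank ℚ K = 2)
    (hodd : Odd (NumberField.discr K)) (hH : SatisfiesHeegnerHypothesis (W.conductorNorm ℤ) K)
    (hs : W.HasSurjectiveModNGaloisRep 2) (hΔ : W.Δ < 0) (hM : 1 ≤ M)
    (htors : ∀ v : HeightOneSpectrum (𝓞 ℚ), ((NumberField.discr K : ℤ) : 𝓞 ℚ) ∈ v.asIdeal →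
      Nat.card (nsmulAddMonoidHom 2 : (W.baseChange (v.adicCompletion ℚ)).toAffine.Point →+ _).ker = 1) :
    IsEmpty (Input W K M hθ hθsq) := by
  refine ⟨fun I ↦ ?_⟩
  have hmem : ((2 : ℤ) ^ (M - 1)) • I.x ∈ selmerGroup W (lvl M) := AddSubgroup.zsmul_mem _ I.x_mem _
  have h2s : (2 : ℤ) • (((2 : ℤ) ^ (M - 1)) • I.x) = 0 := by
    rw [smul_smul, ← pow_succ', Nat.sub_add_cancel hM,
      show ((2 : ℤ) ^ M) = ((2 ^ M : ℕ) : ℤ) by rw [Nat.cast_pow, Nat.cast_ofNat]]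
    exact zsmul_discreteH1_torsion _ I.x
  exact not_sel_visible_of_exists_two_torsion W K M hθ hθsq h2 hodd hH hs hΔ htors hmem h2s I.x_ord I.sel_visible

end Summit.BirchSwinnertonDyer.BirchSwinnertonDyer.Theorems.GenusExact.VisiblePairAtTwo

end
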